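import Summits.MatrixMultiplication.OmegaCensus.Dicyclic40Law
import HarnessLib

/-!
# `β(C₂² × (ℤ_n ⋊ ℤ₄)) = 32⌊2n/3⌋` for every even `n ≥ 6` with `n ≢ 1 (mod 3)`

ω-census, family (b3).  Framing: lottery ticket; floor = certified bounds/negative ranges.

`C₂² × (ℤ_n ⋊ ℤ₄) = G(ℤ₂ × (ℤ₂ × (ℤ₂ × ℤ_n)), (0,(0,(1,0))))` (`c2_product_presentation` on `c2_semidirect_presentation`),
`|A| = 8n`, quotient never cyclic (`z2_z2_z2_zn_quot_noncyclic`).  `3 ∣ n`: general law `64n/3`; `n ≡ 2 (mod 3)`: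
`|A| ≡ 1 (mod 3)` and the P3 exclusion gives `law − 8 = (64n − 32)/3` (`tpp_volume_dicyclic_quot_noncyclic_le`, `8n ≥ 64`);
both `= 32⌊2n/3⌋ = 2β(C₂ × (ℤ_n ⋊ ℤ₄))`, attained by `(C₂, 1, 1) ×` the `C₂ × (ℤ_n ⋊ ℤ₄)` family
(`c2_semidirect_volume_ge`): **`c2c2_semidirect_law`** — e.g. `β(C₂² × (ℤ₆ ⋊ ℤ₄)) = 128`, `β(C₂² × (ℤ₈ ⋊ ℤ₄)) = 160`.
(`n ≡ 1 (mod 3)` even: `|A| ≡ 2 (mod 3)`, dicyclic law `(64n − 16)/3` vs product `(64n − 64)/3`, open.)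
-/

namespace Summit.MatrixMultiplication.OmegaCensus

open Literature.Combinatorics.Additive Finset
open Summit.MatrixMultiplication.MatrixMultiplication.Theorems.JuntaBranch.Planting (tpp_product)

section C2C2SD

variable {n : ℕ} [NeZero n]

omit [NeZero n] in
/-- `A/⟨c₀⟩` is not cyclic for `A = ℤ₂ × (ℤ₂ × (ℤ₂ × ℤ_n))`, `c₀ = (0,(0,(1,0)))` (project to `ℤ₂ × ℤ₂`). [folklore] -/
theorem z2_z2_z2_zn_quot_noncyclic :
    (((0 : ZMod 2), (((0 : ZMod 2), (((1 : ZMod 2), (0 : ZMod n)))))) : ZMod 2 × (ZMod 2 × (ZMod 2 × ZMod n))) ≠ 0 ∧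
    ¬ ∃ g : ZMod 2 × (ZMod 2 × (ZMod 2 × ZMod n)), ∀ x, x ∈ AddSubgroup.zmultiples g ∨
      x + ((0 : ZMod 2), (((0 : ZMod 2), (((1 : ZMod 2), (0 : ZMod n)))))) ∈ AddSubgroup.zmultiples g := by
  refine ⟨fun h0 => ?_, ?_⟩
  · have h1 : ((1 : ZMod 2)) = 0 := congrArg (fun p : ZMod 2 × (ZMod 2 × (ZMod 2 × ZMod n)) => p.2.2.1) h0
    exact one_ne_zero h1
  · rintro ⟨g, hg⟩
    apply not_cyclic_zmod_two_prod (k := 2) (dvd_refl 2)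
    refine ⟨(g.1, g.2.1), fun y => ?_⟩
    have key : ∀ e : ZMod 2, ∀ f : ZMod n, ((y.1, (y.2, (e, f))) : ZMod 2 × (ZMod 2 × (ZMod 2 × ZMod n))) ∈
        AddSubgroup.zmultiples g → y ∈ AddSubgroup.zmultiples (g.1, g.2.1) := by
      intro e f he
      obtain ⟨k, hk⟩ := AddSubgroup.mem_zmultiples_iff.1 he
      refine AddSubgroup.mem_zmultiples_iff.2 ⟨k, ?_⟩
      have h1 := congrArg Prod.fst hk
      have h2 := congrArg (fun p : ZMod 2 × (ZMod 2 × (ZMod 2 × ZMod n)) => p.2.1) hk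
      simp only [Prod.smul_fst, Prod.smul_snd] at h1 h2
      exact Prod.ext h1 h2
    rcases hg (y.1, (y.2, (0, 0))) with h | h
    · exact key 0 0 h
    · refine key 1 0 ?_
      have e : ((y.1, (y.2, ((0 : ZMod 2), (0 : ZMod n)))) : ZMod 2 × (ZMod 2 × (ZMod 2 × ZMod n))) +
          (0, (0, (1, 0))) = (y.1, (y.2, (1, 0))) :=
        Prod.ext (add_zero _) (Prod.ext (add_zero _) (Prod.ext (zero_add _) (add_zero _)))
      rw [e] at h; exact h

/-- **Upper bound** for `C₂² × (ℤ_n ⋊ ℤ₄)`, even `n ≥ 6`, `n ≢ 1 (mod 3)`. [folklore] -/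
theorem c2c2_semidirect_tpp_volume_le (hn2 : 2 ∣ n) (hn : 6 ≤ n) (hmod : n % 3 ≠ 1)
    {S T U : Finset (Multiplicative (ZMod 2) ×
      (Multiplicative (ZMod 2) × DihedralLikeGroup (ZMod 2 × ZMod n) ((1 : ZMod 2), 0)))}
    (h : TripleProductProperty S T U) : S.card * T.card * U.card ≤ 32 * (2 * n / 3) := by
  obtain ⟨hc₀', hnq⟩ := z2_z2_z2_zn_quot_noncyclic (n := n)
  refine c2_semidirect_presentation (n := n) fun ρ τ c₀ hρρ hρτ hτρ hττ hρ hτ hne hsurj hc => ?_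
  subst hc
  refine c2_product_presentation hρρ hρτ hτρ hττ hρ hτ hne hsurj
    fun ρ' τ' c₀' hρρ' hρτ' hτρ' hττ' hρ' hτ' hne' hsurj' hc' => ?_
  subst hc'
  have hcard : Fintype.card (ZMod 2 × (ZMod 2 × (ZMod 2 × ZMod n))) = 8 * n := by
    rw [Fintype.card_prod, Fintype.card_prod, Fintype.card_prod, ZMod.card, ZMod.card]; ring
  by_cases h2 : n % 3 = 2
  · have key := tpp_volume_dicyclic_quot_noncyclic_le hρρ' hρτ' hτρ' hττ' hc₀' hnq hρ' hτ' hne' hsurj'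
      (by rw [hcard]; omega) (by rw [hcard]; omega) h
    rw [hcard] at key
    omega
  · have h0 : n % 3 = 0 := by omega
    have key := tpp_volume_le_of_dihedralLike hρρ' hρτ' hτρ' hττ' hρ' hτ' hne' hsurj' h
    rw [hcard] at key
    omega

/-- **Lower bound**: `(C₂, 1, 1) ×` the `C₂ × (ℤ_n ⋊ ℤ₄)` family (`n ≥ 3`). [folklore] -/
theorem c2c2_semidirect_volume_ge (hn : 3 ≤ n) :
    ∃ S T U : Finset (Multiplicative (ZMod 2) ×
      (Multiplicative (ZMod 2) × DihedralLikeGroup (ZMod 2 × ZMod n) ((1 : ZMod 2), 0))),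
      TripleProductProperty S T U ∧ S.card * T.card * U.card = 32 * (2 * n / 3) := by
  obtain ⟨S, T, U, h, hvol⟩ := c2_semidirect_volume_ge (n := n) hn
  refine ⟨univ ×ˢ S, {1} ×ˢ T, {1} ×ˢ U, tpp_product tpp_univ_one_one h, ?_⟩
  rw [card_product, card_product, card_product, card_univ, card_singleton, Fintype.card_multiplicative, ZMod.card]
  have e : 2 * S.card * (1 * T.card) * (1 * U.card) = 2 * (S.card * T.card * U.card) := by ring
  rw [e, hvol]; ring

/-- **`β(C₂² × (ℤ_n ⋊ ℤ₄)) = 32⌊2n/3⌋ = 2β(C₂ × (ℤ_n ⋊ ℤ₄))` for every even `n ≥ 6` with `n ≢ 1 (mod 3)`** (kernel).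
[folklore] -/
theorem c2c2_semidirect_law (hn2 : 2 ∣ n) (hn : 6 ≤ n) (hmod : n % 3 ≠ 1) :
    (∀ S T U : Finset (Multiplicative (ZMod 2) ×
        (Multiplicative (ZMod 2) × DihedralLikeGroup (ZMod 2 × ZMod n) ((1 : ZMod 2), 0))),
        TripleProductProperty S T U → S.card * T.card * U.card ≤ 32 * (2 * n / 3)) ∧
    ∃ S T U : Finset (Multiplicative (ZMod 2) ×
        (Multiplicative (ZMod 2) × DihedralLikeGroup (ZMod 2 × ZMod n) ((1 : ZMod 2), 0))),
      TripleProductProperty S T U ∧ S.card * T.card * U.card = 32 * (2 * n / 3) :=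
  ⟨fun _ _ _ h => c2c2_semidirect_tpp_volume_le hn2 hn hmod h, c2c2_semidirect_volume_ge (by omega)⟩

end C2C2SD

end Summit.MatrixMultiplication.OmegaCensus
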